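import Summits.Ventures.HSemireg.HomFunctorPushforwardIso
import Summits.Ventures.HSemireg.ComplexAtiyahPushforward
import Literature.AlgebraicGeometry.Modules.PushforwardIsoContract
import HarnessLib

/-!
# Venture HSemireg — the supertrace `Tr•^H : 𝓗om•(K, K ⊗ Ω^q) ⟶ Ω^q[0]` along an isomorphism of `S`-schemes
# (piece (N5) of `HomComplex.IsISemiregularC.of_schemeIso`)

research route conditional on HC_CM; not a corollary; Q11.4-sentence-2 already refuted in dim ≥ 3.

HONEST FRAMING. Kernel bookkeeping on the cell's real carriers (p3's supertrace `HomComplex.supertrace` / t-7's `supertraceH` of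
`HomComplexSupertrace.lean` / `HomComplexSigma.lean`, the last factor `Q(Tr•)` of `σ_q`); nothing about any variety; nothing here says
HC, HC_CM or HC_AV is proved. Seat ring2-b06 gen 119, banked by-name support target `HomComplex.IsISemiregularC.of_schemeIso` of
crux stmt-HodgeConjecture-19787 (ring2 LEAD 152 ruling L152.5 (R3)); complex-level twin of the module-level
`ISemiregularOfSchemeIso.mk₀_comp_mapExactFunctor_traceExtCoeff`. For an isomorphism `e : X₀ ≅ X₁` of `S`-schemes (`e_*`, `e_*•` as in
`ComplexAtiyahPushforward.lean`), a cochain complex `K` of `𝒪_{X₀}`-modules with finite locally free terms and `K' = e_*•K`: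

* §1 `map_contract_comp_comapIso_inv` — the module-level core: `e_*(c^E_{Ω^q}) ≫ (Ω^q_{X₁} ≅ e_*Ω^q_{X₀})⁻¹ =
  (e_*𝓗om(E, E⊗Ω^q) ≅ 𝓗om(e_*E, e_*(E⊗Ω^q))) ≫ 𝓗om(e_*E, α_q) ≫ c^{e_*E}_{Ω^q}` (the tree's `pushforward_map_contract` and the
  naturality of the contraction in the coefficients);
* §2 **`map_supertraceH_comp`** — `e_*•(Tr•^H_K) ≫ (e_*•(Ω^q[0]) ≅ (e_*Ω^q)[0]) ≫ ((Ω^q_{X₁} ≅ e_*Ω^q_{X₀})⁻¹)[0] =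
  τ_{K⊗Ω^q} ≫ 𝓗om•(K', α_q•) ≫ Tr•^H_{K'}`, where `τ` is (N1)'s `homFunctorPushforwardIsoApp` and `α_q•` is (N4)'s
  `twistHodgeComplexPushforwardIso` (a morphism into a single complex: compare degree-`0` components summand by summand,
  `pushforward_ι_hom_ext`; on the summand `𝓗om(K^{-i}, K^{-i} ⊗ Ω^q)` both sides are `(-1)^i` times §1).

References: R.-O. Buchweitz, H. Flenner, Compositio Math. 137 (2003), §4 (trace maps) and Def. 4.1 [BuchweitzFlenner2003];
R. Hartshorne (1977), II Ex. 5.1 (b), II §5 pp. 109–110, II Prop. 8.11 [Hartshorne1977]. Bookkeeping along an isomorphism (reading;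
no printed statement is typed verbatim).
-/

noncomputable section

-- `TopCat.Presheaf`/`Scheme.Modules` are not reducible (as in Mathlib's `AlgebraicGeometry/Modules/Sheaf.lean`).
set_option backward.isDefEq.respectTransparency false

open CategoryTheory CategoryTheory.Category CategoryTheory.Limits AlgebraicGeometry Opposite
open AlgebraicGeometry.Scheme.Modules

universe u

namespace Summit.Ventures.HSemireg

namespace HomComplex

open Literature.AlgebraicGeometry.Modules Literature.AlgebraicGeometry.Motives
open Literature.AlgebraicGeometry.HodgeTheory (leftIso' twistHodgePushforwardIso twistHodge
  sheafHomMap_sheafHomMap_comp_contract)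

variable {S : Type u} [CommRing S] {X₀ X₁ : Over (Spec (CommRingCat.of S))} (e : X₀ ≅ X₁)

/-! ## §0 (N1)'s comparison for an isomorphism of `S`-schemes, retyped with `e.hom.left` -/

section Retype

variable (K : CochainComplex X₀.left.Modules ℤ)

/-- (N1)'s `ε_*• 𝓗om•(K, L) ≅ 𝓗om•(ε_*•K, ε_*•L)` for `ε = leftIso' e`, RETYPED with every push-forward spelled `pushforward e.hom.left`
(the spelling of `ComplexAtiyahPushforward.lean`; keeps all later compositions syntactically well-typed). [folklore] -/
def homFunctorOverPushforwardIso (L : CochainComplex X₀.left.Modules ℤ) :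
    ((pushforward e.hom.left).mapHomologicalComplex (ComplexShape.up ℤ)).obj ((homFunctor X₀.left K).obj L) ≅
      (homFunctor X₁.left (((pushforward e.hom.left).mapHomologicalComplex (ComplexShape.up ℤ)).obj K)).obj
        (((pushforward e.hom.left).mapHomologicalComplex (ComplexShape.up ℤ)).obj L) :=
  homFunctorPushforwardIsoApp (leftIso' e) K L

/-- `homFunctorOverPushforwardIso` is (N1)'s component (definitional). [folklore] -/
theorem homFunctorOverPushforwardIso_hom (L : CochainComplex X₀.left.Modules ℤ) :
    (homFunctorOverPushforwardIso e K L).hom = (homFunctorPushforwardIso (leftIso' e) K).hom.app L := rfl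

/-- On summands (retyped `map_ι_comp_homFunctorPushforwardIsoApp_hom_f`). [folklore] -/
theorem map_ι_comp_homFunctorOverPushforwardIso_hom_f (L : CochainComplex X₀.left.Modules ℤ) (q i n : ℤ) (h : q + i = n) :
    (pushforward e.hom.left).map (ι X₀.left K L q i n h) ≫ (homFunctorOverPushforwardIso e K L).hom.f n =
      (sheafHomPushforwardIso (leftIso' e) (K.X (-i)) (L.X q)).hom ≫
        ι X₁.left (((pushforward e.hom.left).mapHomologicalComplex (ComplexShape.up ℤ)).obj K)
          (((pushforward e.hom.left).mapHomologicalComplex (ComplexShape.up ℤ)).obj L) q i n h :=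
  map_ι_comp_homFunctorPushforwardIsoApp_hom_f (leftIso' e) K L q i n h

/-- A morphism out of `e_*(𝓗om•(K, L)^n)` is determined by its compositions with the `e_*(ι_{q,i})` (retyped `pushforward_ι_hom_ext`).
[folklore] -/
theorem over_pushforward_ι_hom_ext {L : CochainComplex X₀.left.Modules ℤ} {n : ℤ} {T : X₁.left.Modules}
    {f g : (pushforward e.hom.left).obj ((homComplex X₀.left K L).X n) ⟶ T}
    (h : ∀ (q i : ℤ) (hqi : q + i = n),
      (pushforward e.hom.left).map (ι X₀.left K L q i n hqi) ≫ f = (pushforward e.hom.left).map (ι X₀.left K L q i n hqi) ≫ g) :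
    f = g :=
  pushforward_ι_hom_ext (leftIso' e) K h

end Retype

/-! ## §1 The module-level core -/

/-- **The contraction with coefficients `Ω^q` along `e_*`, landing in `Ω^q_{X₁}`**:
`e_*(c^E_{Ω^q_{X₀}}) ≫ (Ω^q_{X₁} ≅ e_*Ω^q_{X₀})⁻¹ = (e_*𝓗om(E, E⊗Ω^q) ≅ 𝓗om(e_*E, e_*(E⊗Ω^q))) ≫ 𝓗om(e_*E, α_q) ≫ c^{e_*E}_{Ω^q_{X₁}}`.
[cite: Hartshorne1977, II Ex. 5.1 (b) (the evaluation E^∨ ⊗ E ⊗ G → G; reading: its compatibility with direct images along an isomorphism)] -/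
theorem map_contract_comp_comapIso_inv {E : X₀.left.Modules} (hE : IsFiniteLocallyFree E)
    (hE' : IsFiniteLocallyFree ((pushforward e.hom.left).obj E)) (q : ℕ) :
    (pushforward e.hom.left).map (contract hE (hodgeSheaf X₀ q)) ≫
        (Literature.AlgebraicGeometry.HodgeTheory.hodgeSheaf.comapIso e q).inv =
      (sheafHomPushforwardIso (leftIso' e) E (twistHodge E q)).hom ≫
        sheafHomMap ((pushforward e.hom.left).obj E) (twistHodgePushforwardIso e E q).hom ≫
          contract hE' (hodgeSheaf X₁ q) := by
  erw [pushforward_map_contract (leftIso' e) hE (hodgeSheaf X₀ q)]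
  simp only [twistHodgePushforwardIso, Iso.trans_hom, Functor.mapIso_hom, Iso.symm_hom, sheafHomFunctor_map,
    sheafHomMap_comp, Category.assoc]
  rw [sheafHomMap_sheafHomMap_comp_contract hE']

/-! ## §2 The supertrace along `e_*•` -/

/-- The degree-`0` component of `Tr•^H` (unfolding `supertraceH`, `supertrace`, `mkHomToSingle`). [folklore] -/
theorem supertraceH_f_zero (X : Over (Spec (CommRingCat.of S))) (K : CochainComplex X.left.Modules ℤ)
    (hK : ∀ p, IsFiniteLocallyFree (K.X p)) (q : ℕ) :
    (supertraceH X K hK q).f 0 =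
      ((homFunctor X.left K).map (twistHodgeIsoG X K q).hom).f 0 ≫ str₀ X.left (hodgeSheaf X q) K hK ≫
        (HomologicalComplex.singleObjXSelf (ComplexShape.up ℤ) 0 (hodgeSheaf X q)).inv := by
  rw [supertraceH, HomologicalComplex.comp_f, supertrace, HomologicalComplex.mkHomToSingle_f]

variable (K : CochainComplex X₀.left.Modules ℤ) (hK : ∀ p, IsFiniteLocallyFree (K.X p))
  (hK' : ∀ p, IsFiniteLocallyFree ((((pushforward e.hom.left).mapHomologicalComplex (ComplexShape.up ℤ)).obj K).X p))

/-- The left summand: `e_*(ι_{-i,i}) ≫ e_*(𝓗om•(K, (K⊗Ω^q ≅ K⊗G))_0) ≫ e_*(str₀) = (-1)^i • e_*(c^{K^{-i}}_{Ω^q})`. [folklore] -/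
theorem map_ι_comp_map_str₀ (q : ℕ) (i : ℤ) (h : -i + i = 0) :
    (pushforward e.hom.left).map (ι X₀.left K (twistHodgeComplex X₀ q K) (-i) i 0 h) ≫
        (pushforward e.hom.left).map (((homFunctor X₀.left K).map (twistHodgeIsoG X₀ K q).hom).f 0) ≫
          (pushforward e.hom.left).map (str₀ X₀.left (hodgeSheaf X₀ q) K hK) =
      (i.negOnePow : ℤ) • (pushforward e.hom.left).map (contract (hK (-i)) (hodgeSheaf X₀ q)) := by
  rw [← Functor.map_comp, ← Functor.map_comp, homFunctor_map_f, reassoc_of% (ι_map X₀.left K (twistHodgeIsoG X₀ K q).hom (-i) i 0 h),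
    ι_str₀]
  erw [show (twistHodgeIsoG X₀ K q).hom.f (-i) = 𝟙 _ from rfl, sheafHomMap_id, Category.id_comp]
  simp only [strComp, HomologicalComplex.XIsoOfEq_rfl, Iso.refl_hom, sheafHomMap_id, Category.id_comp, Units.smul_def,
    Functor.map_zsmul]

/-- The right summand: `e_*(ι) ≫ τ_0 ≫ 𝓗om•(K', α•)_0 ≫ 𝓗om•(K', (≅))_0 ≫ str₀' = (-1)^i • ((e_*𝓗om ≅ 𝓗om e_*) ≫ 𝓗om(e_*K^{-i}, α_q) ≫ c')`.
[folklore] -/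
theorem map_ι_comp_iso_comp_str₀ (q : ℕ) (i : ℤ) (h : -i + i = 0) :
    (pushforward e.hom.left).map (ι X₀.left K (twistHodgeComplex X₀ q K) (-i) i 0 h) ≫
        (homFunctorOverPushforwardIso e K (twistHodgeComplex X₀ q K)).hom.f 0 ≫
          (((homFunctor X₁.left (((pushforward e.hom.left).mapHomologicalComplex (ComplexShape.up ℤ)).obj K)).map
              (twistHodgeComplexPushforwardIso e q K).hom).f 0) ≫
            (((homFunctor X₁.left (((pushforward e.hom.left).mapHomologicalComplex (ComplexShape.up ℤ)).obj K)).map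
                (twistHodgeIsoG X₁ (((pushforward e.hom.left).mapHomologicalComplex (ComplexShape.up ℤ)).obj K) q).hom).f 0) ≫
              str₀ X₁.left (hodgeSheaf X₁ q) (((pushforward e.hom.left).mapHomologicalComplex (ComplexShape.up ℤ)).obj K) hK' =
      (i.negOnePow : ℤ) • ((sheafHomPushforwardIso (leftIso' e) (K.X (-i)) (twistHodge (K.X (-i)) q)).hom ≫
        sheafHomMap ((pushforward e.hom.left).obj (K.X (-i))) (twistHodgePushforwardIso e (K.X (-i)) q).hom ≫
          contract (hK' (-i)) (hodgeSheaf X₁ q)) := by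
  rw [reassoc_of% (map_ι_comp_homFunctorOverPushforwardIso_hom_f e K (twistHodgeComplex X₀ q K) (-i) i 0 h),
    homFunctor_map_f, homFunctor_map_f,
    reassoc_of% (ι_map X₁.left (((pushforward e.hom.left).mapHomologicalComplex (ComplexShape.up ℤ)).obj K)
      (twistHodgeComplexPushforwardIso e q K).hom (-i) i 0 h),
    reassoc_of% (ι_map X₁.left (((pushforward e.hom.left).mapHomologicalComplex (ComplexShape.up ℤ)).obj K)
      (twistHodgeIsoG X₁ (((pushforward e.hom.left).mapHomologicalComplex (ComplexShape.up ℤ)).obj K) q).hom (-i) i 0 h),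
    ι_str₀, twistHodgeComplexPushforwardIso_hom_f]
  erw [show (twistHodgeIsoG X₁ (((pushforward e.hom.left).mapHomologicalComplex (ComplexShape.up ℤ)).obj K) q).hom.f (-i) = 𝟙 _
    from rfl, sheafHomMap_id, Category.id_comp]
  simp only [strComp, HomologicalComplex.XIsoOfEq_rfl, Iso.refl_hom, sheafHomMap_id, Category.id_comp, Units.smul_def,
    Preadditive.comp_zsmul]
  rfl

/-- **The supertrace along an isomorphism of `S`-schemes**: `e_*•(Tr•^H_K) ≫ (e_*•(Ω^q_{X₀}[0]) ≅ (e_*Ω^q_{X₀})[0]) ≫ ((Ω^q_{X₁} ≅ e_*Ω^q_{X₀})⁻¹)[0]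
= τ_{K ⊗ Ω^q} ≫ 𝓗om•(e_*•K, α_q•) ≫ Tr•^H_{e_*•K}` as morphisms `e_*• 𝓗om•(K, K ⊗ Ω^q_{X₀}) ⟶ Ω^q_{X₁}[0]`.
[cite: BuchweitzFlenner2003, §4 (the trace map Tr : Ext^k(F, F ⊗ G) → H^k(X, G); reading: its compatibility with an isomorphism of the ambient scheme)] -/
theorem map_supertraceH_comp (q : ℕ) :
    ((pushforward e.hom.left).mapHomologicalComplex (ComplexShape.up ℤ)).map (supertraceH X₀ K hK q) ≫
        (HomologicalComplex.singleMapHomologicalComplex (pushforward e.hom.left) (ComplexShape.up ℤ) 0).hom.app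
            (hodgeSheaf X₀ q) ≫
          (HomologicalComplex.single X₁.left.Modules (ComplexShape.up ℤ) 0).map
            (Literature.AlgebraicGeometry.HodgeTheory.hodgeSheaf.comapIso e q).inv =
      (homFunctorOverPushforwardIso e K (twistHodgeComplex X₀ q K)).hom ≫
        (homFunctor X₁.left (((pushforward e.hom.left).mapHomologicalComplex (ComplexShape.up ℤ)).obj K)).map
            (twistHodgeComplexPushforwardIso e q K).hom ≫
          supertraceH X₁ (((pushforward e.hom.left).mapHomologicalComplex (ComplexShape.up ℤ)).obj K) hK' q := by
  refine HomologicalComplex.to_single_hom_ext ?_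
  simp only [HomologicalComplex.comp_f, Functor.mapHomologicalComplex_map_f,
    HomologicalComplex.singleMapHomologicalComplex_hom_app_self, HomologicalComplex.single_map_f_self, Category.assoc,
    Iso.inv_hom_id_assoc, supertraceH_f_zero, Functor.map_comp, Iso.map_inv_hom_id_assoc]
  refine over_pushforward_ι_hom_ext e K fun p i hpi => ?_
  obtain rfl : p = -i := by omega
  rw [reassoc_of% (map_ι_comp_map_str₀ e K hK q i hpi), reassoc_of% (map_ι_comp_iso_comp_str₀ e K hK' q i hpi),
    Preadditive.zsmul_comp, Preadditive.zsmul_comp, reassoc_of% (map_contract_comp_comapIso_inv e (hK (-i)) (hK' (-i)) q)]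
  simp only [Category.assoc]

end HomComplex

end Summit.Ventures.HSemireg

end
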